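/-
Copyright: lit-balaban cell, Phase-2 proof seat p24 (gen 23).  Released under Apache 2.0 license as described in the
file LICENSE.
-/
import Literature.MathematicalPhysics.QuantumFieldTheory.Balaban1983to89.B4Eq245Aliasing

/-!
# `Balaban1983to89.B4Eq244L2Unique` — [Balaban1983RegularityDecay] p. 584, (2.44) «Defining the propagator G_j, φ₀ = G_jf»:
# the operator `−Δ^ξ + m² + aQ_j^*Q_j` is INJECTIVE ON `ℓ²(ξℤ^d)` (positivity), so `G_j` is well defined as a left inverse
# on square-summable fields

statement-level skeleton of published theorems with citation tags; proofs where landed; nothing here is a claim about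
the Yang–Mills mass gap

CITATION HEADER.  T. Bałaban, *Regularity and decay of lattice Green's functions*, Commun. Math. Phys. **89** (1983)
571–597, doi:10.1007/bf01214744 [Balaban1983RegularityDecay] (cell paper B4; held text
`paper:balaban1983-cmp89-regularity-decay`, journal page = PDF page + 570), p. 572 [PDF 2] (1.3)–(1.6) and p. 584 [PDF 14]
(2.44); renders `pub-balaban/b2b-balaban-ref1/pages/1983-cmp89-regularity-decay/1983-cmp89-regularity-decay-p002-x2.png`,
`…-p014-x2.png` (unit `lit-balaban-p24` gen 23; HOME `run/shared/lean/pub/lit-balaban/`; SKELETON row **B4.Eq2.43**; companion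
of `B4Eq246SummableSolution` (uniqueness of `ℓ¹` solutions by the printed Fourier route) and of `B4Green244`, whose SCOPE note
(ii) — «uniqueness of ℓ² solutions, i.e. injectivity of D ≥ m² + aQ^*Q on ℓ² — is not typed here (remark: for a > 0 it follows
from −Δ^ξ ≥ 0, Q^*Q ≥ 0 and ker(−Δ^ξ) ∩ ker Q = 0 on ℓ²)» — this file turns into a theorem).

WHAT IS PRINTED.  p. 572: «(1.3) ⟨φ,(−Δ^{η,N}_{A,Ω})φ⟩ = Σ_{b⊂Ω} η^d|η^{−1}(U(A_b)φ(b₊) − φ(b₋))|² […] (1.5) P_k(A) = Q_k^*(A)Q_k(A)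
[…] (1.6) G_k(Ω,A) = (−Δ^{η,N}_{A,Ω} + m² + aP_k(A))^{−1}, where m² ≥ 0 and a is a positive constant»; p. 584: «(2.44)
(−Δ^ξ + m_j² + a_jQ_j^*Q_j)φ₀ = f.  Defining the propagator G_j, φ₀ = G_jf, …».

WHAT THIS MODULE PROVES (kernel-checked; theorems only; 0 `sorry`; 0 `Prop` facts; axioms standard), for the tree's
`D = B4Green244.opD n a m²` on the infinite fine lattice `ξℤ^d` (`A = 0`) and square-summable `φ` (`Σ_z|φ(z)|² < ∞`):
* `tsum_conj_mul_secondDiff` — **(1.3) at `A = 0` summed by parts on `ℓ²`**: `Σ_z φ̄(z)(2φ(z) − φ(z+e_μ) − φ(z−e_μ)) =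
  Σ_z |φ(z+e_μ) − φ(z)|²` (each direction `μ`);
* `tsum_conj_mul_blockAvg` — **(1.5): `⟨φ, Q^*Qφ⟩ = ‖Qφ‖²`** on `ℓ²`: `Σ_z φ̄(z)(Q^*Qφ)(z) = n^{−d}Σ_x |Σ_{z∈B(x)} φ(z)|²`;
* `tsum_conj_mul_opD` — hence `⟨φ, Dφ⟩ = n²Σ_μ‖∇_μφ‖² + m²‖φ‖² + a·n^{−d}Σ_x|Σ_{B(x)}φ|²`, a sum of non-negative reals for
  `a ≥ 0`, `m² ≥ 0`;
* **`eq_zero_of_opD_eq_zero_l2`** — **INJECTIVITY ON `ℓ²`**: `Dφ = 0`, `φ ∈ ℓ²(ℤ^d)`, `d ≥ 1`, `a ≥ 0`, `m² ≥ 0` ⇒ `φ = 0`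
  (`⟨φ,Dφ⟩ = 0` kills every gradient, a gradient-free field on the connected lattice `ℤ^d` is constant —
  `eq_const_of_forall_shift` — and a square-summable constant on an infinite lattice vanishes); **`opD_injective_l2`** — two
  `ℓ²` fields with the same image under `D` coincide: «the propagator G_j» names at most one square-summable `φ₀` —
  since `ℓ¹(ℤ^d) ⊂ ℓ²(ℤ^d)` this contains the `ℓ¹` uniqueness `B4Eq246SummableSolution.solution_unique_of_nonneg` (proved there
  by the printed Fourier route (2.43)–(2.46); not re-stated here).

DICTIONARY / HONEST SCOPE.  (i) `A = 0`, infinite lattice, scalar fields (the setting of (2.43)–(2.48)); `a_j ↦ a ≥ 0`,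
`m_j² ↦ m² ≥ 0`; lattice dimension `d ≥ 1` (on `ℤ⁰` = one point `D = m² + a` and injectivity needs `m² + a ≠ 0`).  (ii) This is
the UNIQUENESS half of «φ₀ = G_jf» on `ℓ²`; existence (surjectivity onto a given class, decay of `G_j`) is not claimed — the
tree has it for block sources `f = Q_j^*g` (`B4Green244.green244`, `B4Eq247TransformGQ.GQ`).  (iii) No claim about `A ≠ 0`,
regions `Ω`, or the torus.  Value = kernel certificate of the well-definedness of `G_j` in (2.44) on `ℓ²`; NOT summit progress.
-/

namespace Literature.MathematicalPhysics.QuantumFieldTheory.Balaban1983to89.B4Eq244L2Unique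

open Complex Finset
open Literature.MathematicalPhysics.QuantumFieldTheory.Balaban1983to89.B4Green244
open Literature.MathematicalPhysics.QuantumFieldTheory.Balaban1983to89.B4Eq245Aliasing (blockEquiv)
open scoped Real ComplexConjugate

noncomputable section

variable {d : ℕ}

/-! ### §1 `ℓ²` bookkeeping -/

/-- `|āb| ≤ (|a|² + |b|²)/2`: the product of two square-summable fields is summable. [folklore] -/
private theorem summable_conj_mul {φ ψ : (Fin d → ℤ) → ℂ} (hφ : Summable fun z => ‖φ z‖ ^ 2)
    (hψ : Summable fun z => ‖ψ z‖ ^ 2) : Summable fun z => conj (φ z) * ψ z := by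
  refine Summable.of_norm_bounded ((hφ.add hψ).div_const 2) fun z => ?_
  rw [norm_mul, Complex.norm_conj]
  nlinarith [sq_nonneg (‖φ z‖ - ‖ψ z‖), norm_nonneg (φ z), norm_nonneg (ψ z)]

/-- a translate of a square-summable field is square-summable. [folklore] -/
private theorem summable_sq_shift {φ : (Fin d → ℤ) → ℂ} (hφ : Summable fun z => ‖φ z‖ ^ 2) (c : Fin d → ℤ) :
    Summable fun z => ‖φ (z + c)‖ ^ 2 := by
  simpa only [Function.comp_def] using hφ.comp_injective (add_left_injective c)

/-- `Σ_z |φ(z)|²` as a complex number: `Σ_z φ̄(z)φ(z)`. [folklore] -/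
private theorem tsum_conj_mul_self {φ : (Fin d → ℤ) → ℂ} :
    ∑' z, conj (φ z) * φ z = ∑' z, ((‖φ z‖ ^ 2 : ℝ) : ℂ) := by
  refine tsum_congr fun z => ?_
  rw [Complex.conj_mul']
  push_cast
  rfl

/-! ### §2 (1.3) at `A = 0`: summation by parts on `ℓ²(ℤ^d)` -/

/-- **(1.3) SUMMED BY PARTS ON `ℓ²`** (one direction `μ`, `A = 0`, the whole lattice): for square-summable `φ`,
`Σ_z φ̄(z)·(2φ(z) − φ(z+e_μ) − φ(z−e_μ)) = Σ_z |φ(z+e_μ) − φ(z)|²` — the discrete Dirichlet form is the quadratic form of the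
second difference. [cite: Balaban1983RegularityDecay, (1.3) p.572, (2.44) p.584] -/
theorem tsum_conj_mul_secondDiff {φ : (Fin d → ℤ) → ℂ} (hφ : Summable fun z => ‖φ z‖ ^ 2) (μ : Fin d) :
    ∑' z, conj (φ z) * (2 * φ z - φ (z + e μ) - φ (z - e μ)) = ∑' z, ((‖φ (z + e μ) - φ z‖ ^ 2 : ℝ) : ℂ) := by
  -- the four summable pieces
  have hP : Summable fun z => conj (φ z) * φ z := summable_conj_mul hφ hφ
  have hB : Summable fun z => conj (φ z) * φ (z + e μ) := summable_conj_mul hφ (summable_sq_shift hφ (e μ))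
  have hC : Summable fun z => conj (φ z) * φ (z - e μ) := by
    have := summable_sq_shift hφ (-e μ)
    simp_rw [← sub_eq_add_neg] at this
    exact summable_conj_mul hφ this
  have hQ : Summable fun z => conj (φ (z + e μ)) * φ z :=
    summable_conj_mul (summable_sq_shift hφ (e μ)) hφ
  have hP' : Summable fun z => conj (φ (z + e μ)) * φ (z + e μ) :=
    summable_conj_mul (summable_sq_shift hφ (e μ)) (summable_sq_shift hφ (e μ))
  -- left side `= 2P − B − C`
  have hL : ∑' z, conj (φ z) * (2 * φ z - φ (z + e μ) - φ (z - e μ))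
      = 2 * ∑' z, conj (φ z) * φ z - ∑' z, conj (φ z) * φ (z + e μ) - ∑' z, conj (φ z) * φ (z - e μ) := by
    have h1 : ∀ z, conj (φ z) * (2 * φ z - φ (z + e μ) - φ (z - e μ))
        = (2 * (conj (φ z) * φ z) - conj (φ z) * φ (z + e μ)) - conj (φ z) * φ (z - e μ) := fun z => by ring
    simp_rw [h1]
    rw [(((hP.mul_left 2).sub hB)).tsum_sub hC, (hP.mul_left 2).tsum_sub hB, tsum_mul_left]
  -- right side `= P' − Q − B + P` with `P' = P`, `Q = C` after translation
  have hR : ∑' z, ((‖φ (z + e μ) - φ z‖ ^ 2 : ℝ) : ℂ)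
      = ∑' z, conj (φ (z + e μ)) * φ (z + e μ) - ∑' z, conj (φ (z + e μ)) * φ z
        - ∑' z, conj (φ z) * φ (z + e μ) + ∑' z, conj (φ z) * φ z := by
    have h1 : ∀ z, ((‖φ (z + e μ) - φ z‖ ^ 2 : ℝ) : ℂ)
        = ((conj (φ (z + e μ)) * φ (z + e μ) - conj (φ (z + e μ)) * φ z) - conj (φ z) * φ (z + e μ))
          + conj (φ z) * φ z := by
      intro z
      push_cast
      rw [← Complex.conj_mul', map_sub]
      ring
    simp_rw [h1]
    rw [((hP'.sub hQ).sub hB).tsum_add hP, (hP'.sub hQ).tsum_sub hB, hP'.tsum_sub hQ]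
  have hshift1 : ∑' z, conj (φ (z + e μ)) * φ (z + e μ) = ∑' z, conj (φ z) * φ z :=
    (Equiv.addRight (e μ)).tsum_eq (fun z => conj (φ z) * φ z)
  have hshift2 : ∑' z, conj (φ (z + e μ)) * φ z = ∑' z, conj (φ z) * φ (z - e μ) := by
    have := (Equiv.addRight (e μ)).tsum_eq (fun z => conj (φ z) * φ (z - e μ))
    simpa using this
  rw [hL, hR, hshift1, hshift2]
  ring

/-- the Dirichlet form is a non-negative real. [cite: Balaban1983RegularityDecay, (1.3) p.572] -/
theorem summable_normSq_diff {φ : (Fin d → ℤ) → ℂ} (hφ : Summable fun z => ‖φ z‖ ^ 2) (μ : Fin d) :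
    Summable fun z => ‖φ (z + e μ) - φ z‖ ^ 2 := by
  refine Summable.of_nonneg_of_le (fun z => sq_nonneg _) (fun z => ?_)
    (((summable_sq_shift hφ (e μ)).add hφ).mul_left 2)
  have := norm_sub_le (φ (z + e μ)) (φ z)
  nlinarith [norm_nonneg (φ (z + e μ) - φ z), norm_nonneg (φ (z + e μ)), norm_nonneg (φ z),
    sq_nonneg (‖φ (z + e μ)‖ - ‖φ z‖)]

/-! ### §3 (1.5): `⟨φ, Q^*Qφ⟩ = ‖Qφ‖²` on `ℓ²` -/

/-- the block sum `Σ_{z ∈ B(x)} φ(z)` of the fine points over the unit-lattice point `x`.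
[cite: Balaban1983RegularityDecay, (1.4) p.572, dictionary] -/
def blockSum (n : ℕ) (φ : (Fin d → ℤ) → ℂ) (x : Fin d → ℤ) : ℂ := ∑ j : Fin d → Fin n, φ (finePt n x j)

/-- `(Q^*Qφ)(z) = n^{−d}·blockSum φ (⌊z/n⌋)`. [cite: Balaban1983RegularityDecay, (1.4)–(1.5) p.572, dictionary] -/
theorem blockAvg_eq_blockSum (n : ℕ) (φ : (Fin d → ℤ) → ℂ) (z : Fin d → ℤ) :
    blockAvg n φ z = ((n : ℂ) ^ d)⁻¹ * blockSum n φ (coarse n z) := rfl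

/-- Cauchy–Schwarz on a block: `|Σ_{B(x)} φ|² ≤ n^d Σ_{B(x)} |φ|²`. [folklore] -/
private theorem normSq_blockSum_le (n : ℕ) (φ : (Fin d → ℤ) → ℂ) (x : Fin d → ℤ) :
    ‖blockSum n φ x‖ ^ 2 ≤ (n : ℝ) ^ d * ∑ j : Fin d → Fin n, ‖φ (finePt n x j)‖ ^ 2 := by
  have h1 : ‖blockSum n φ x‖ ≤ ∑ j : Fin d → Fin n, ‖φ (finePt n x j)‖ * 1 := by
    simpa [blockSum] using norm_sum_le (Finset.univ : Finset (Fin d → Fin n)) (fun j => φ (finePt n x j))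
  have h2 := Finset.sum_mul_sq_le_sq_mul_sq (Finset.univ : Finset (Fin d → Fin n))
    (fun j => ‖φ (finePt n x j)‖) (fun _ => (1 : ℝ))
  have hcard : ∑ _j : Fin d → Fin n, (1 : ℝ) ^ 2 = (n : ℝ) ^ d := by simp
  rw [hcard] at h2
  have h0 : 0 ≤ ∑ j : Fin d → Fin n, ‖φ (finePt n x j)‖ * 1 := Finset.sum_nonneg fun j _ => by positivity
  calc ‖blockSum n φ x‖ ^ 2 ≤ (∑ j : Fin d → Fin n, ‖φ (finePt n x j)‖ * 1) ^ 2 :=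
        pow_le_pow_left₀ (norm_nonneg _) h1 2
    _ ≤ (∑ j : Fin d → Fin n, ‖φ (finePt n x j)‖ ^ 2) * (n : ℝ) ^ d := h2
    _ = (n : ℝ) ^ d * ∑ j : Fin d → Fin n, ‖φ (finePt n x j)‖ ^ 2 := mul_comm _ _

/-- `Σ_x Σ_{B(x)} |φ|² = Σ_z |φ(z)|²` (blocks partition the fine lattice): the block sums of an `ℓ²` field are square-summable,
`Σ_x |blockSum φ x|² ≤ n^d Σ_z |φ(z)|²`. [folklore] -/
private theorem summable_normSq_blockSum (n : ℕ) [NeZero n] {φ : (Fin d → ℤ) → ℂ}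
    (hφ : Summable fun z => ‖φ z‖ ^ 2) : Summable fun x => ‖blockSum n φ x‖ ^ 2 := by
  have h1 : Summable fun xj : (Fin d → ℤ) × (Fin d → Fin n) => ‖φ (finePt n xj.1 xj.2)‖ ^ 2 := by
    have := (blockEquiv n).summable_iff.mpr hφ
    have h3 : (fun z => ‖φ z‖ ^ 2) ∘ blockEquiv n
        = fun xj : (Fin d → ℤ) × (Fin d → Fin n) => ‖φ (finePt n xj.1 xj.2)‖ ^ 2 := by
      funext xj
      simp only [Function.comp, blockEquiv, Equiv.coe_fn_mk]
    rw [h3] at this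
    exact this
  have h2 : Summable fun x : Fin d → ℤ => ∑ j : Fin d → Fin n, ‖φ (finePt n x j)‖ ^ 2 := by
    have := h1.prod
    simpa [tsum_fintype] using this
  refine Summable.of_nonneg_of_le (fun x => sq_nonneg _) (fun x => normSq_blockSum_le n φ x) (h2.mul_left _)

/-- the pairing `φ̄·Q^*Qφ` is summable on `ℓ²`. [folklore] -/
private theorem summable_conj_mul_blockAvg (n : ℕ) [NeZero n] {φ : (Fin d → ℤ) → ℂ}
    (hφ : Summable fun z => ‖φ z‖ ^ 2) : Summable fun z => conj (φ z) * blockAvg n φ z := by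
  have hS := summable_normSq_blockSum n hφ
  -- `z ↦ |blockSum (⌊z/n⌋)|²` is summable on the fine lattice (each block value repeated `n^d` times)
  have hSc : Summable fun z : Fin d → ℤ => ‖blockSum n φ (coarse n z)‖ ^ 2 := by
    rw [← (blockEquiv n).summable_iff]
    have h3 : (fun z : Fin d → ℤ => ‖blockSum n φ (coarse n z)‖ ^ 2) ∘ blockEquiv n
        = fun xj : (Fin d → ℤ) × (Fin d → Fin n) => ‖blockSum n φ xj.1‖ ^ 2 := by
      funext xj
      simp only [Function.comp, blockEquiv, Equiv.coe_fn_mk, coarse_finePt]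
    rw [h3]
    refine (summable_prod_of_nonneg (fun xj => sq_nonneg _)).mpr ⟨fun x => (hasSum_fintype _).summable, ?_⟩
    simp_rw [tsum_fintype, Finset.sum_const, Finset.card_univ, nsmul_eq_mul]
    exact hS.mul_left _
  have hψ : Summable fun z => ‖blockAvg n φ z‖ ^ 2 := by
    simp_rw [blockAvg_eq_blockSum, norm_mul, mul_pow]
    exact hSc.mul_left _
  exact summable_conj_mul hφ hψ

/-- **(1.5) ON `ℓ²`: `⟨φ, Q^*Qφ⟩ = ‖Qφ‖²`** — `Σ_z φ̄(z)(Q^*Qφ)(z) = n^{−d}Σ_x |Σ_{z∈B(x)} φ(z)|²`, a non-negative real.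
[cite: Balaban1983RegularityDecay, (1.4)–(1.5) p.572, (2.44) p.584] -/
theorem tsum_conj_mul_blockAvg (n : ℕ) [NeZero n] {φ : (Fin d → ℤ) → ℂ} (hφ : Summable fun z => ‖φ z‖ ^ 2) :
    ∑' z, conj (φ z) * blockAvg n φ z = ((n : ℂ) ^ d)⁻¹ * ∑' x, ((‖blockSum n φ x‖ ^ 2 : ℝ) : ℂ) := by
  have hsum := summable_conj_mul_blockAvg n hφ
  -- re-index the fine lattice by blocks
  rw [← (blockEquiv n).tsum_eq]
  have h1 : ∀ xj : (Fin d → ℤ) × (Fin d → Fin n),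
      conj (φ (blockEquiv n xj)) * blockAvg n φ (blockEquiv n xj)
        = ((n : ℂ) ^ d)⁻¹ * (conj (φ (finePt n xj.1 xj.2)) * blockSum n φ xj.1) := by
    intro xj
    simp only [blockEquiv, Equiv.coe_fn_mk, blockAvg_eq_blockSum, coarse_finePt]
    ring
  simp_rw [h1]
  rw [tsum_mul_left]
  congr 1
  have h2 : Summable fun xj : (Fin d → ℤ) × (Fin d → Fin n) => conj (φ (finePt n xj.1 xj.2)) * blockSum n φ xj.1 := by
    have h3 := (blockEquiv n).summable_iff.mpr hsum
    have h4 : (fun z => conj (φ z) * blockAvg n φ z) ∘ blockEquiv n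
        = fun xj : (Fin d → ℤ) × (Fin d → Fin n) => ((n : ℂ) ^ d)⁻¹ * (conj (φ (finePt n xj.1 xj.2)) * blockSum n φ xj.1) := by
      funext xj; exact h1 xj
    rw [h4] at h3
    have hn : ((n : ℂ) ^ d)⁻¹ ≠ 0 := inv_ne_zero (pow_ne_zero _ (Nat.cast_ne_zero.mpr (NeZero.ne n)))
    exact (summable_mul_left_iff hn).mp h3
  rw [h2.tsum_prod' (fun x => (hasSum_fintype _).summable)]
  refine tsum_congr fun x => ?_
  rw [tsum_fintype]
  show ∑ j : Fin d → Fin n, conj (φ (finePt n x j)) * blockSum n φ x = _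
  rw [← Finset.sum_mul, blockSum, ← map_sum, Complex.conj_mul', ← blockSum]
  norm_cast

/-! ### §4 `⟨φ, Dφ⟩` and injectivity on `ℓ²` -/

/-- **`⟨φ, Dφ⟩ = n²Σ_μ‖∇_μφ‖² + m²‖φ‖² + a·n^{−d}Σ_x|Σ_{B(x)}φ|²`** for `φ ∈ ℓ²(ℤ^d)`: the quadratic form of the operator of
(2.44) is a sum of non-negative terms (`a ≥ 0`, `m² ≥ 0`). [cite: Balaban1983RegularityDecay, (1.3)–(1.6) p.572, (2.44) p.584] -/
theorem tsum_conj_mul_opD (n : ℕ) [NeZero n] (a m2 : ℝ) {φ : (Fin d → ℤ) → ℂ} (hφ : Summable fun z => ‖φ z‖ ^ 2) :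
    ∑' z, conj (φ z) * opD n a m2 φ z
      = (n : ℂ) ^ 2 * ∑ μ, ∑' z, ((‖φ (z + e μ) - φ z‖ ^ 2 : ℝ) : ℂ)
        + m2 * ∑' z, ((‖φ z‖ ^ 2 : ℝ) : ℂ)
        + a * (((n : ℂ) ^ d)⁻¹ * ∑' x, ((‖blockSum n φ x‖ ^ 2 : ℝ) : ℂ)) := by
  have hP : Summable fun z => conj (φ z) * φ z := summable_conj_mul hφ hφ
  have hD : ∀ μ : Fin d, Summable fun z => conj (φ z) * (2 * φ z - φ (z + e μ) - φ (z - e μ)) := by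
    intro μ
    have hB : Summable fun z => conj (φ z) * φ (z + e μ) := summable_conj_mul hφ (summable_sq_shift hφ (e μ))
    have hC : Summable fun z => conj (φ z) * φ (z - e μ) := by
      have := summable_sq_shift hφ (-e μ)
      simp_rw [← sub_eq_add_neg] at this
      exact summable_conj_mul hφ this
    have := ((hP.mul_left 2).sub hB).sub hC
    refine this.congr fun z => ?_
    ring
  have hL : Summable fun z => conj (φ z) * negLap n φ z := by
    have := (summable_sum fun μ (_ : μ ∈ Finset.univ) => hD μ).mul_left ((n : ℂ) ^ 2)
    refine this.congr fun z => ?_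
    simp only [negLap, Finset.mul_sum]
    exact Finset.sum_congr rfl fun μ _ => by ring
  have hM : Summable fun z => conj (φ z) * ((m2 : ℂ) * φ z) := by
    refine (hP.mul_left (m2 : ℂ)).congr fun z => ?_; ring
  have hA : Summable fun z => conj (φ z) * ((a : ℂ) * blockAvg n φ z) := by
    refine ((summable_conj_mul_blockAvg n hφ).mul_left (a : ℂ)).congr fun z => ?_; ring
  have h1 : ∀ z, conj (φ z) * opD n a m2 φ z
      = conj (φ z) * negLap n φ z + conj (φ z) * ((m2 : ℂ) * φ z) + conj (φ z) * ((a : ℂ) * blockAvg n φ z) := by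
    intro z; simp only [opD]; ring
  simp_rw [h1]
  rw [(hL.add hM).tsum_add hA, hL.tsum_add hM]
  -- the three pieces
  have e1 : ∑' z, conj (φ z) * negLap n φ z = (n : ℂ) ^ 2 * ∑ μ, ∑' z, ((‖φ (z + e μ) - φ z‖ ^ 2 : ℝ) : ℂ) := by
    have h2 : ∀ z, conj (φ z) * negLap n φ z
        = (n : ℂ) ^ 2 * ∑ μ, conj (φ z) * (2 * φ z - φ (z + e μ) - φ (z - e μ)) := by
      intro z; simp only [negLap, Finset.mul_sum]; ring_nf
    simp_rw [h2]
    rw [tsum_mul_left, Summable.tsum_finsetSum (fun μ _ => hD μ)]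
    congr 1
    exact Finset.sum_congr rfl fun μ _ => tsum_conj_mul_secondDiff hφ μ
  have e2 : ∑' z, conj (φ z) * ((m2 : ℂ) * φ z) = m2 * ∑' z, ((‖φ z‖ ^ 2 : ℝ) : ℂ) := by
    rw [← tsum_conj_mul_self, ← tsum_mul_left]
    exact tsum_congr fun z => by ring
  have e3 : ∑' z, conj (φ z) * ((a : ℂ) * blockAvg n φ z)
      = a * (((n : ℂ) ^ d)⁻¹ * ∑' x, ((‖blockSum n φ x‖ ^ 2 : ℝ) : ℂ)) := by
    rw [← tsum_conj_mul_blockAvg n hφ, ← tsum_mul_left]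
    exact tsum_congr fun z => by ring
  rw [e1, e2, e3]

/-- a field on `ℤ^d` invariant under every unit translation is constant (the lattice is connected).
[cite: Balaban1983RegularityDecay, (1.3) p.572, dictionary] -/
theorem eq_const_of_forall_shift {φ : (Fin d → ℤ) → ℂ} (h : ∀ z μ, φ (z + e μ) = φ z) (z : Fin d → ℤ) : φ z = φ 0 := by
  classical
  -- invariance under `k • e_μ`, `k : ℤ`
  have hk : ∀ (w : Fin d → ℤ) (μ : Fin d) (k : ℤ), φ (w + k • e μ) = φ w := by
    intro w μ k
    induction k using Int.induction_on with
    | zero => simp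
    | succ i ih => rw [add_smul, one_smul, ← add_assoc, h, ih]
    | pred i ih =>
      have h1 := h (w + (-(i : ℤ) - 1) • e μ) μ
      have h2 : w + (-(i : ℤ) - 1) • e μ + e μ = w + (-(i : ℤ)) • e μ := by
        rw [sub_smul, one_smul]; abel
      rw [h2] at h1
      rw [← h1, ih]
  -- invariance under any lattice vector, by `z = Σ_μ z_μ • e_μ`
  have hsum : ∀ (s : Finset (Fin d)) (w : Fin d → ℤ), φ (w + ∑ μ ∈ s, z μ • e μ) = φ w := by
    intro s
    induction s using Finset.induction_on with
    | empty => intro w; simp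
    | insert μ s hμ ih => intro w; rw [Finset.sum_insert hμ, ← add_assoc, ih (w + z μ • e μ), hk]
  have hz : z = ∑ μ, z μ • e μ := by
    unfold e
    simp_rw [← Pi.single_smul, smul_eq_mul, mul_one]
    exact (Finset.univ_sum_single z).symm
  have := hsum Finset.univ 0
  rw [zero_add, ← hz] at this
  exact this

/-- **INJECTIVITY OF `−Δ^ξ + m² + aQ_j^*Q_j` ON `ℓ²(ℤ^d)`** (`d ≥ 1`, `a ≥ 0`, `m² ≥ 0`): a square-summable `φ` with `Dφ = 0`
vanishes — `⟨φ,Dφ⟩ = 0` forces `∇_μφ = 0` for every `μ`, so `φ` is constant, and a square-summable constant on the infinite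
lattice is `0`.  «The propagator G_j» of (2.44) is thus well defined as a left inverse on `ℓ²`.
[cite: Balaban1983RegularityDecay, (1.6) p.572, (2.44) p.584] -/
theorem eq_zero_of_opD_eq_zero_l2 (n : ℕ) [NeZero n] (hd : 0 < d) {a m2 : ℝ} (ha : 0 ≤ a) (hm : 0 ≤ m2)
    {φ : (Fin d → ℤ) → ℂ} (hφ : Summable fun z => ‖φ z‖ ^ 2) (h : ∀ z, opD n a m2 φ z = 0) : φ = 0 := by
  have hform := tsum_conj_mul_opD n a m2 hφ
  simp_rw [h, mul_zero, tsum_zero] at hform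
  -- the three non-negative reals
  set G : Fin d → ℝ := fun μ => ∑' z, ‖φ (z + e μ) - φ z‖ ^ 2 with hG
  set A : ℝ := ∑' z, ‖φ z‖ ^ 2 with hA
  set B : ℝ := ∑' x, ‖blockSum n φ x‖ ^ 2 with hB
  have hG0 : ∀ μ, 0 ≤ G μ := fun μ => tsum_nonneg fun z => sq_nonneg _
  have hA0 : 0 ≤ A := tsum_nonneg fun z => sq_nonneg _
  have hB0 : 0 ≤ B := tsum_nonneg fun x => sq_nonneg _
  have hreal : (0 : ℂ) = (((n : ℝ) ^ 2 * ∑ μ, G μ + m2 * A + a * (((n : ℝ) ^ d)⁻¹ * B) : ℝ) : ℂ) := by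
    rw [hform]
    simp_rw [hG, hA, hB]
    push_cast
    ring
  have hzero : (n : ℝ) ^ 2 * ∑ μ, G μ + m2 * A + a * (((n : ℝ) ^ d)⁻¹ * B) = 0 := by
    exact_mod_cast hreal.symm
  have hn : (0 : ℝ) < (n : ℝ) ^ 2 := by
    have : (0 : ℝ) < n := by exact_mod_cast Nat.pos_of_ne_zero (NeZero.ne n)
    positivity
  have hsumG : ∑ μ, G μ = 0 := by
    have h1 : 0 ≤ ∑ μ, G μ := Finset.sum_nonneg fun μ _ => hG0 μ
    have h2 : 0 ≤ m2 * A := mul_nonneg hm hA0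
    have h3 : 0 ≤ a * (((n : ℝ) ^ d)⁻¹ * B) := mul_nonneg ha (mul_nonneg (by positivity) hB0)
    nlinarith
  have hGμ : ∀ μ, G μ = 0 := fun μ =>
    (Finset.sum_eq_zero_iff_of_nonneg (fun μ _ => hG0 μ)).mp hsumG μ (Finset.mem_univ μ)
  -- every gradient vanishes
  have hgrad : ∀ z μ, φ (z + e μ) = φ z := by
    intro z μ
    have hs := summable_normSq_diff hφ μ
    have h0 : (fun z => ‖φ (z + e μ) - φ z‖ ^ 2) = 0 := by
      have hsum0 : HasSum (fun z => ‖φ (z + e μ) - φ z‖ ^ 2) 0 := by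
        rw [← hGμ μ]
        exact hs.hasSum
      exact (hasSum_zero_iff_of_nonneg (fun z => sq_nonneg (‖φ (z + e μ) - φ z‖))).mp hsum0
    have := congrFun h0 z
    simp only [Pi.zero_apply, ne_eq, OfNat.ofNat_ne_zero, not_false_eq_true, pow_eq_zero_iff, norm_eq_zero,
      sub_eq_zero] at this
    exact this
  -- so `φ` is the constant `φ 0`, square-summable on an infinite lattice
  have hconst : φ = fun _ => φ 0 := funext fun z => eq_const_of_forall_shift hgrad z
  haveI : NeZero d := ⟨hd.ne'⟩
  haveI : Infinite (Fin d → ℤ) := inferInstance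
  have hc : Summable fun _ : Fin d → ℤ => ‖φ 0‖ ^ 2 := by rw [hconst] at hφ; exact hφ
  have h0 : ‖φ 0‖ ^ 2 = 0 := (summable_const_iff _).mp hc
  have hφ0 : φ 0 = 0 := by simpa using h0
  rw [hconst, hφ0]
  rfl

/-- `D` is linear: `D(φ₁ − φ₂) = Dφ₁ − Dφ₂` (finite stencil). [cite: Balaban1983RegularityDecay, (2.44) p.584, dictionary] -/
theorem opD_sub (n : ℕ) (a m2 : ℝ) (φ₁ φ₂ : (Fin d → ℤ) → ℂ) (z : Fin d → ℤ) :
    opD n a m2 (φ₁ - φ₂) z = opD n a m2 φ₁ z - opD n a m2 φ₂ z := by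
  simp only [opD_eq_stencil, Pi.sub_apply, mul_sub, Finset.sum_sub_distrib]

/-- **UNIQUENESS OF `ℓ²` SOLUTIONS OF (2.44)** (`d ≥ 1`, `a ≥ 0`, `m² ≥ 0`): two square-summable fields with the same image
under `−Δ^ξ + m² + aQ_j^*Q_j` coincide. [cite: Balaban1983RegularityDecay, (2.44) p.584] -/
theorem opD_injective_l2 (n : ℕ) [NeZero n] (hd : 0 < d) {a m2 : ℝ} (ha : 0 ≤ a) (hm : 0 ≤ m2)
    {φ₁ φ₂ : (Fin d → ℤ) → ℂ} (h₁ : Summable fun z => ‖φ₁ z‖ ^ 2) (h₂ : Summable fun z => ‖φ₂ z‖ ^ 2)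
    (h : ∀ z, opD n a m2 φ₁ z = opD n a m2 φ₂ z) : φ₁ = φ₂ := by
  have hdiff : Summable fun z => ‖(φ₁ - φ₂) z‖ ^ 2 := by
    refine Summable.of_nonneg_of_le (fun z => sq_nonneg _) (fun z => ?_) ((h₁.add h₂).mul_left 2)
    have := norm_sub_le (φ₁ z) (φ₂ z)
    simp only [Pi.sub_apply]
    nlinarith [norm_nonneg (φ₁ z - φ₂ z), norm_nonneg (φ₁ z), norm_nonneg (φ₂ z), sq_nonneg (‖φ₁ z‖ - ‖φ₂ z‖)]
  have h0 := eq_zero_of_opD_eq_zero_l2 n hd ha hm hdiff fun z => by rw [opD_sub, h z, sub_self]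
  exact sub_eq_zero.mp h0

end

end Literature.MathematicalPhysics.QuantumFieldTheory.Balaban1983to89.B4Eq244L2Unique
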